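import Literature.Barriers.Parity.SiegelZeroDichotomyPairHLProp72
import HarnessLib

/-!
# Tao–Teräväinen 2022, Proposition 7.2 at `k = 2`, `ℓ = 0` in the `≈`-form, and the reduction of
# `TaoTeravainen2021_prop72_81_pair` to Proposition 8.1

Topic `Literature/Barriers/Parity`; a file of the proof DAG of the named fact
`Literature.Barriers.Parity.TaoTeravainen2021_prop72_81_pair` (Tao–Teräväinen, *The
Hardy–Littlewood–Chowla conjecture in the presence of a Siegel zero*, J. London Math. Soc. (2) 106
(2022), arXiv:2109.06291, Propositions 7.2 and 8.1 concatenated at `k = 2`, `ℓ = 0`; file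
`SiegelZeroDichotomyPairHLSiegelModel.lean`), after `…Prop72.lean` (Proposition 7.2 at `k = 2` with a
power saving, `TaoTeravainen.prop72_pair`: `|∑ Λ♭_Siegel(n+h)Λ_Siegel(n+h')|`,
`|∑ Λ♭_Siegel(n+h)Λ♭_Siegel(n+h')| ≤ C x^{1-c}`). PROVED here:

* `TaoTeravainen2021_prop72_pair_approx` — **Proposition 7.2 at `k = 2`, `ℓ = 0` in the shape of
  the standing conventions of §2.1** ("`X ≈ Y`" is `X = Y + O(log^{-1/20} η)`, (2.11) at `k = 2`;
  "`η` sufficiently large depending on the fixed quantities"; the range (1.5)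
  `q^{41/2+ε₀} ≤ x ≤ q^{√η}`; the scales (2.8) `R = x^{1/log^{1/10} η}` and (2.9)
  `D = x^{ε₀/20}`): `|𝔼_{n ≤ x} Λ_Siegel(n+h₁)Λ_Siegel(n+h₂) - 𝔼_{n ≤ x} Λ♯_Siegel(n+h₁)Λ♯_Siegel(n+h₂)|
  ≤ C / log^{1/20} η`. From `prop72_pair` (error `C x^{-c}`; the pair difference is
  `Λ♭(a)Λ_S(b) + Λ♭(b)Λ_S(a) - Λ♭(a)Λ♭(b)`, `a = n+h₁`, `b = n+h₂`) with (1.4) (Siegel: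
  `η ≪ q ≤ x`, `exists_siegelZero_quality_le`) to make `q`, `x` large and to bound
  `log^{1/20} η ≤ log η ≪ log x ≪ x^c`, and `R = x^{1/log^{1/10} η} ≤ x^c` for `log η ≥ c^{-10}`.
* `TaoTeravainen2021_prop72_81_pair_of_prop81` — **the concatenation "(iv) ≈ (v)"**: the named
  fact `TaoTeravainen2021_prop72_81_pair` follows from Proposition 8.1 at `k = 2`, `ℓ = 0` for the
  same Type I approximant `Λ♯_Siegel = (χ∗log)♯ ν` (hypothesis `h81`, stated for a fixed bump `φ`
  in the conventions above: `𝔼_{n ≤ x} Λ♯_Siegel(n+h₁)Λ♯_Siegel(n+h₂) ≈ 𝔖`), by the triangle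
  inequality with `ε₀` shrunk to the smaller threshold and `η₁`, `C` combined. This leaves
  Proposition 8.1 (`k = 2`, `ℓ = 0`) as the one remaining input of
  `TaoTeravainen2021_prop72_81_pair_holds`.
  [cite: TaoTeravainen2021, Proposition 7.2, §8 (first paragraph: "Theorem 1.6 follows immediately
  from concatenating together Propositions 4.2, 5.2, 6.3, 7.2, 8.1"), §2.1, (1.4), (2.8), (2.9), (2.11)]
-/

noncomputable section

open Finset Real
open scoped ContDiff Topology

namespace Literature.Barriers.Parity

open TaoTeravainen

/-! ### Proposition 7.2 (`k = 2`, `ℓ = 0`) in the `≈`-form -/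

/-- **Tao–Teräväinen 2022, Proposition 7.2 at `k = 2`, `ℓ = 0` (`≈`-form).** For distinct shifts,
a smooth cutoff `ψ` and a bump `φ`: with `ε₁ = 1/100`, for every `0 < ε₀ ≤ ε₁` there are `C`, `η₁`
such that for every Siegel zero of quality `η ≥ η₁` and conductor `q` and all
`q^{41/2+ε₀} ≤ x ≤ q^{√η}`,
`|𝔼_{n ≤ x} Λ_Siegel(n+h₁)Λ_Siegel(n+h₂) - 𝔼_{n ≤ x} Λ♯_Siegel(n+h₁)Λ♯_Siegel(n+h₂)| ≤ C / log^{1/20} η`,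
`Λ_Siegel = (χ∗log)ν` at level `R = x^{1/log^{1/10} η}` and `Λ♯_Siegel = (χ∗log)♯ ν` with
`X = log x`, `U₀ = log(D q²)`, `D = x^{ε₀/20}`. [cite: TaoTeravainen2021, Proposition 7.2
(k = 2, ℓ = 0; with §2.1, (1.4), (2.8), (2.9), (2.11))] -/
theorem TaoTeravainen2021_prop72_pair_approx {h₁ h₂ : ℕ} (hne : h₁ ≠ h₂) {ψ : ℝ → ℝ}
    (hψ : IsSmoothCutoff ψ) {φ : ℝ → ℝ} (hφ : IsBump φ) :
    ∃ ε₁ : ℝ, 0 < ε₁ ∧ ∀ ε₀ : ℝ, 0 < ε₀ → ε₀ ≤ ε₁ →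
      ∃ C η₁ : ℝ, ∀ (q : ℕ) [NeZero q] (χ : DirichletCharacter ℂ q) (η : ℝ), IsSiegelZero χ η →
        η₁ ≤ η → ∀ x : ℕ, (q : ℝ) ^ ((41 : ℝ) / 2 + ε₀) ≤ x → (x : ℝ) ≤ (q : ℝ) ^ Real.sqrt η →
          |pairAverage (vonMangoldtSiegel χ ψ (pairScaleR η x)) h₁ h₂ x -
              pairAverage (vonMangoldtSiegelSharp χ φ ψ (Real.log x)
                (ε₀ / 20 * Real.log x + 2 * Real.log q) (pairScaleR η x)) h₁ h₂ x| ≤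
            C / Real.log η ^ ((1 : ℝ) / 20) := by
  refine ⟨1 / 100, by norm_num, fun ε₀ hε₀ hε₀1 => ?_⟩
  obtain ⟨c, hc, C, hC, x₀, hP⟩ := prop72_pair hφ hψ hε₀ hε₀1 (max h₁ h₂)
  obtain ⟨CS, hCS, hSiegel⟩ := exists_siegelZero_quality_le one_pos
  set cS : ℝ := 1 + |Real.log CS| with hcS
  have hcS1 : 1 ≤ cS := by rw [hcS]; linarith [abs_nonneg (Real.log CS)]
  -- thresholds on `η`: `log η ≥ max(1, c^{-10})` and `η ≥ CS x₀` (so that `q ≥ x₀`)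
  set η₁ : ℝ := max (Real.exp (max 1 ((1 / c) ^ (10 : ℕ)))) (CS * x₀ + 10) with hη₁
  refine ⟨3 * C * cS / c, η₁, fun q _ χ η hS hη x hlo hhi => ?_⟩
  -- sizes of `q`, `x`, `η`
  have hq3 : (3 : ℝ) ≤ q := by exact_mod_cast hS.three_le
  have hq1 : (1 : ℝ) ≤ q := by linarith
  have hq0 : (0 : ℝ) < q := by linarith
  have hη0 : 0 < η := by linarith [hS.ten_le]
  have hηexp : Real.exp (max 1 ((1 / c) ^ (10 : ℕ))) ≤ η := le_trans (le_max_left _ _) hη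
  have hlogη : max 1 ((1 / c) ^ (10 : ℕ)) ≤ Real.log η := by
    rw [← Real.log_exp (max 1 ((1 / c) ^ (10 : ℕ)))]
    exact Real.log_le_log (Real.exp_pos _) hηexp
  have hlogη1 : 1 ≤ Real.log η := le_trans (le_max_left _ _) hlogη
  have hlogηc : (1 / c) ^ (10 : ℕ) ≤ Real.log η := le_trans (le_max_right _ _) hlogη
  have hηx₀ : CS * x₀ + 10 ≤ η := le_trans (le_max_right _ _) hη
  -- `q ≥ x₀` from Siegel: `η ≤ CS q`
  have hηq : η ≤ CS * q := by
    have := hSiegel q χ η hS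
    rwa [Real.rpow_one] at this
  have hqx₀ : (x₀ : ℝ) ≤ q := by
    by_contra h
    push Not at h
    have : CS * q < CS * x₀ := mul_lt_mul_of_pos_left h hCS
    linarith
  -- `x ≥ q ≥ x₀`, `q ≤ x^{1/20}`
  have hqpow : (q : ℝ) ≤ (q : ℝ) ^ ((41 : ℝ) / 2 + ε₀) := by
    calc (q : ℝ) = (q : ℝ) ^ (1 : ℝ) := (Real.rpow_one _).symm
      _ ≤ (q : ℝ) ^ ((41 : ℝ) / 2 + ε₀) := Real.rpow_le_rpow_of_exponent_le hq1 (by linarith)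
  have hqx : (q : ℝ) ≤ x := hqpow.trans hlo
  have hxx₀ : x₀ ≤ x := by
    have : (x₀ : ℝ) ≤ x := hqx₀.trans hqx
    exact_mod_cast this
  have hx1 : (1 : ℝ) ≤ x := by linarith
  have hx0 : (0 : ℝ) < x := by linarith
  have hq20 : (q : ℝ) ≤ (x : ℝ) ^ (1 / 20 : ℝ) := by
    have h1 : ((q : ℝ) ^ ((41 : ℝ) / 2 + ε₀)) ^ (1 / 20 : ℝ) ≤ (x : ℝ) ^ (1 / 20 : ℝ) :=
      Real.rpow_le_rpow (by positivity) hlo (by norm_num)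
    rw [← Real.rpow_mul hq0.le] at h1
    refine le_trans ?_ h1
    calc (q : ℝ) = (q : ℝ) ^ (1 : ℝ) := (Real.rpow_one _).symm
      _ ≤ (q : ℝ) ^ (((41 : ℝ) / 2 + ε₀) * (1 / 20)) :=
          Real.rpow_le_rpow_of_exponent_le hq1 (by nlinarith)
  -- the level `R = x^{1/log^{1/10} η}`: `1 < R ≤ x^c`
  have hlogη0 : 0 < Real.log η := by linarith
  have hL10 : 0 < Real.log η ^ ((1 : ℝ) / 10) := Real.rpow_pos_of_pos hlogη0 _
  have hL10c : 1 / c ≤ Real.log η ^ ((1 : ℝ) / 10) := by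
    have h1 : ((1 / c) ^ (10 : ℕ)) ^ ((1 : ℝ) / 10) ≤ Real.log η ^ ((1 : ℝ) / 10) :=
      Real.rpow_le_rpow (by positivity) hlogηc (by norm_num)
    have h2 : ((1 / c) ^ (10 : ℕ)) ^ ((1 : ℝ) / 10) = 1 / c := by
      rw [show ((1 : ℝ) / 10) = ((10 : ℕ) : ℝ)⁻¹ by norm_num]
      exact Real.pow_rpow_inv_natCast (by positivity) (by norm_num)
    rw [h2] at h1
    exact h1
  have hx3 : (3 : ℝ) ≤ x := hq3.trans hqx
  have hR1 : 1 < pairScaleR η x := by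
    unfold pairScaleR
    exact Real.one_lt_rpow (by linarith) (by positivity)
  have hRc : pairScaleR η x ≤ (x : ℝ) ^ c := by
    unfold pairScaleR
    refine Real.rpow_le_rpow_of_exponent_le hx1 ?_
    rw [div_le_iff₀ hL10]
    calc (1 : ℝ) = 1 / c * c := by field_simp
      _ ≤ Real.log η ^ ((1 : ℝ) / 10) * c := mul_le_mul_of_nonneg_right hL10c hc.le
      _ = c * Real.log η ^ ((1 : ℝ) / 10) := mul_comm _ _
  -- the power-saving bounds (both orders of the shifts)
  set R : ℝ := pairScaleR η x with hRdef
  set X : ℝ := Real.log x with hXdef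
  set U₀ : ℝ := ε₀ / 20 * Real.log x + 2 * Real.log q with hU₀def
  obtain ⟨b₁, b₂⟩ := hP x hxx₀ q χ hS.2.1 hq20 R hR1 hRc h₁ h₂ (le_max_left _ _) (le_max_right _ _) hne
  obtain ⟨b₃, -⟩ := hP x hxx₀ q χ hS.2.1 hq20 R hR1 hRc h₂ h₁ (le_max_right _ _) (le_max_left _ _)
    hne.symm
  -- `Λ_S(a)Λ_S(b) - Λ♯(a)Λ♯(b) = Λ♭(a)Λ_S(b) + Λ♭(b)Λ_S(a) - Λ♭(a)Λ♭(b)`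
  have hpt : ∀ n : ℕ, vonMangoldtSiegel χ ψ R (n + h₁) * vonMangoldtSiegel χ ψ R (n + h₂) -
      vonMangoldtSiegelSharp χ φ ψ X U₀ R (n + h₁) * vonMangoldtSiegelSharp χ φ ψ X U₀ R (n + h₂) =
      vonMangoldtSiegelFlat χ φ ψ X U₀ R (n + h₁) * vonMangoldtSiegel χ ψ R (n + h₂) +
        vonMangoldtSiegelFlat χ φ ψ X U₀ R (n + h₂) * vonMangoldtSiegel χ ψ R (n + h₁) -
        vonMangoldtSiegelFlat χ φ ψ X U₀ R (n + h₁) * vonMangoldtSiegelFlat χ φ ψ X U₀ R (n + h₂) := by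
    intro n
    rw [vonMangoldtSiegel_eq_sharp_add_flat χ φ ψ X U₀ R (n + h₁),
      vonMangoldtSiegel_eq_sharp_add_flat χ φ ψ X U₀ R (n + h₂)]
    ring
  have hb : |∑ n ∈ Icc 1 x, (vonMangoldtSiegel χ ψ R (n + h₁) * vonMangoldtSiegel χ ψ R (n + h₂) -
      vonMangoldtSiegelSharp χ φ ψ X U₀ R (n + h₁) * vonMangoldtSiegelSharp χ φ ψ X U₀ R (n + h₂))| ≤
      3 * C * (x : ℝ) ^ (1 - c) := by
    simp_rw [hpt]
    rw [Finset.sum_sub_distrib, Finset.sum_add_distrib]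
    calc _ ≤ |∑ n ∈ Icc 1 x, vonMangoldtSiegelFlat χ φ ψ X U₀ R (n + h₁) * vonMangoldtSiegel χ ψ R (n + h₂) +
          ∑ n ∈ Icc 1 x, vonMangoldtSiegelFlat χ φ ψ X U₀ R (n + h₂) * vonMangoldtSiegel χ ψ R (n + h₁)| +
          |∑ n ∈ Icc 1 x, vonMangoldtSiegelFlat χ φ ψ X U₀ R (n + h₁) *
            vonMangoldtSiegelFlat χ φ ψ X U₀ R (n + h₂)| := abs_sub _ _
      _ ≤ (C * (x : ℝ) ^ (1 - c) + C * (x : ℝ) ^ (1 - c)) + C * (x : ℝ) ^ (1 - c) :=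
          add_le_add ((abs_add_le _ _).trans (add_le_add b₁ b₃)) b₂
      _ = 3 * C * (x : ℝ) ^ (1 - c) := by ring
  -- the averages
  have havg : |pairAverage (vonMangoldtSiegel χ ψ R) h₁ h₂ x -
      pairAverage (vonMangoldtSiegelSharp χ φ ψ X U₀ R) h₁ h₂ x| ≤ 3 * C * (x : ℝ) ^ (-c) := by
    unfold pairAverage
    rw [← sub_div, ← Finset.sum_sub_distrib, abs_div, abs_of_pos hx0, div_le_iff₀ hx0]
    calc _ ≤ 3 * C * (x : ℝ) ^ (1 - c) := hb
      _ = 3 * C * (x : ℝ) ^ (-c) * x := by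
          rw [show (1 - c : ℝ) = -c + 1 by ring, Real.rpow_add hx0, Real.rpow_one]; ring
  -- `log^{1/20} η ≤ cS log x ≤ cS x^c / c`
  have hlogx : 1 ≤ Real.log x :=
    (Real.le_log_iff_exp_le hx0).mpr (by linarith [Real.exp_one_lt_d9])
  have hηCx : η ≤ CS * x := hηq.trans (mul_le_mul_of_nonneg_left hqx hCS.le)
  have hL20le : Real.log η ^ ((1 : ℝ) / 20) ≤ cS * Real.log x :=
    rpow_log_le_of_le_mul hη0 hCS hx0 hlogx hlogη1 hηCx
  have hlogpow : Real.log x ≤ (x : ℝ) ^ c / c := Real.log_le_rpow_div hx0.le hc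
  have hL20 : 0 < Real.log η ^ ((1 : ℝ) / 20) := Real.rpow_pos_of_pos hlogη0 _
  rw [le_div_iff₀ hL20]
  have hxc0 : 0 < (x : ℝ) ^ c := Real.rpow_pos_of_pos hx0 c
  calc |pairAverage (vonMangoldtSiegel χ ψ R) h₁ h₂ x -
        pairAverage (vonMangoldtSiegelSharp χ φ ψ X U₀ R) h₁ h₂ x| * Real.log η ^ ((1 : ℝ) / 20)
      ≤ (3 * C * (x : ℝ) ^ (-c)) * (cS * ((x : ℝ) ^ c / c)) :=
        mul_le_mul havg (hL20le.trans (mul_le_mul_of_nonneg_left hlogpow (by linarith)))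
          hL20.le (by positivity)
    _ = 3 * C * cS / c * ((x : ℝ) ^ (-c) * (x : ℝ) ^ c) := by ring
    _ = 3 * C * cS / c := by rw [Real.rpow_neg hx0.le, inv_mul_cancel₀ hxc0.ne', mul_one]

/-! ### The concatenation with Proposition 8.1 -/

/-- **`TaoTeravainen2021_prop72_81_pair` from Proposition 8.1 (`k = 2`, `ℓ = 0`)** ("(iv) ≈ (v)":
"Theorem 1.6 follows immediately from concatenating together Propositions … 7.2, 8.1"). The
hypothesis `h81` is Proposition 8.1 at `k = 2`, `ℓ = 0` in the standing conventions of §2.1, for a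
fixed bump `φ` and the Type I approximant `Λ♯_Siegel = (χ∗log)♯ ν` of §7 (`vonMangoldtSiegelSharp`
with `X = log x`, `U₀ = log(D q²)`, `D = x^{ε₀/20}`, `R = x^{1/log^{1/10} η}`):
`|𝔼_{n ≤ x} Λ♯_Siegel(n+h₁)Λ♯_Siegel(n+h₂) - 𝔖| ≤ C / log^{1/20} η` for `η ≥ η₁`, `x` in (1.5),
after shrinking `ε₀`. Given it, Proposition 7.2 (`TaoTeravainen2021_prop72_pair_approx`) and the
triangle inequality give the fact (with `ε₁` the smaller threshold, `η₁` the larger, `C` the sum).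
[cite: TaoTeravainen2021, §8 (first paragraph) with Propositions 7.2 and 8.1 (k = 2, ℓ = 0)] -/
theorem TaoTeravainen2021_prop72_81_pair_of_prop81 {φ : ℝ → ℝ} (hφ : IsBump φ)
    (h81 : ∀ h₁ h₂ : ℕ, 1 ≤ h₁ → 1 ≤ h₂ → h₁ ≠ h₂ → ∀ ψ : ℝ → ℝ, IsSmoothCutoff ψ →
      ∃ ε₁ : ℝ, 0 < ε₁ ∧ ∀ ε₀ : ℝ, 0 < ε₀ → ε₀ ≤ ε₁ →
        ∃ C η₁ : ℝ, ∀ (q : ℕ) [NeZero q] (χ : DirichletCharacter ℂ q) (η : ℝ), IsSiegelZero χ η →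
          η₁ ≤ η → ∀ x : ℕ, (q : ℝ) ^ ((41 : ℝ) / 2 + ε₀) ≤ x → (x : ℝ) ≤ (q : ℝ) ^ Real.sqrt η →
            |pairAverage (vonMangoldtSiegelSharp χ φ ψ (Real.log x)
                (ε₀ / 20 * Real.log x + 2 * Real.log q) (pairScaleR η x)) h₁ h₂ x -
                Literature.NumberTheory.Sieve.singularSeries ({(h₁ : ℤ), (h₂ : ℤ)} : Finset ℤ)| ≤
              C / Real.log η ^ ((1 : ℝ) / 20)) :
    TaoTeravainen2021_prop72_81_pair := by
  intro h₁ h₂ hh₁ hh₂ hne ψ hψ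
  obtain ⟨εA, hεA, HA⟩ := TaoTeravainen2021_prop72_pair_approx hne hψ hφ
  obtain ⟨εB, hεB, HB⟩ := h81 h₁ h₂ hh₁ hh₂ hne ψ hψ
  refine ⟨min εA εB, lt_min hεA hεB, fun ε₀ hε₀ hε₀le => ?_⟩
  obtain ⟨CA, ηA, hCA⟩ := HA ε₀ hε₀ (hε₀le.trans (min_le_left _ _))
  obtain ⟨CB, ηB, hCB⟩ := HB ε₀ hε₀ (hε₀le.trans (min_le_right _ _))
  refine ⟨CA + CB, max ηA ηB, fun q _ χ η hS hη x hlo hhi => ?_⟩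
  have eA := hCA q χ η hS ((le_max_left _ _).trans hη) x hlo hhi
  have eB := hCB q χ η hS ((le_max_right _ _).trans hη) x hlo hhi
  have hlogη : 0 < Real.log η := Real.log_pos (by linarith [hS.ten_le])
  have hL : 0 < Real.log η ^ ((1 : ℝ) / 20) := Real.rpow_pos_of_pos hlogη _
  set A := pairAverage (vonMangoldtSiegel χ ψ (pairScaleR η x)) h₁ h₂ x
  set M := pairAverage (vonMangoldtSiegelSharp χ φ ψ (Real.log x)
    (ε₀ / 20 * Real.log x + 2 * Real.log q) (pairScaleR η x)) h₁ h₂ x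
  set 𝔖 : ℝ := Literature.NumberTheory.Sieve.singularSeries ({(h₁ : ℤ), (h₂ : ℤ)} : Finset ℤ)
  calc |A - 𝔖| = |(A - M) + (M - 𝔖)| := by rw [show (A - M) + (M - 𝔖) = A - 𝔖 by ring]
    _ ≤ |A - M| + |M - 𝔖| := abs_add_le _ _
    _ ≤ CA / Real.log η ^ ((1 : ℝ) / 20) + CB / Real.log η ^ ((1 : ℝ) / 20) := add_le_add eA eB
    _ = (CA + CB) / Real.log η ^ ((1 : ℝ) / 20) := by ring

end Literature.Barriers.Parity
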